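import Mathlib
import Summits.ABC.ABC.Theses.GvfSupportTransfer

/-!
# Birth skeleton (BC3) of split piece `LowGenusCurveLaw` (child of crux `LinearLawTransfer`, stmt-ABC-11084)

KNOWN piece (Weil height machine + Néron–Tate on curves of genus ≤ 1): the law holds asymptotically along the
rational points of an irreducible plane curve `P = 0` whose function field `ℚ(P) = Frac(ℚ[X,Y]/(P))` has
`deg D + 1 − ℓ(D) ≤ 1` for all divisors over `ℚ`. Three registered stubs — (1) the complex-function-field law
DESCENDS to a degree inequality on `ℚ(P)` (constant-field extension, Stichtenoth III.6), (2) the projective degree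
of `(1 : x̄ : ȳ)` on `ℚ(P)` is positive (a transcendental element has a pole), (3) the HEIGHT MACHINE on the curve:
`h(T_j(x,y)) = (deg_j/d)·h(1:x:y) + o(h)` along rational points (Weil functoriality + Néron quasi-orthogonality,
Hindry–Silverman Thm B.5.9) — and the kernel-checked composition `LowGenusCurveLaw_of` (bookkeeping over `ℝ` plus the
degenerate case `P ∣ T_ji`, in which the curve carries no admissible rational point). Sorries ONLY inside `stub_*`.
Notation in statements: `x̄, ȳ` = images of `X, Y` in `Frac(ℚ[X,Y]/(P))`; `deg_j := Σ_v deg v · max_i(−ord_v T_ji(x̄,ȳ))`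
over `PlaceOver ℚ`, `d := Σ_v deg v · max(0, −ord_v x̄, −ord_v ȳ)`.
-/

set_option linter.dupNamespace false

namespace Summit.ABC.ABC.Cruxes.LinearLawTransfer.Split

open scoped BigOperators
open Literature.NumberTheory.DiophantineGeometry

/-- Split piece X₂ (support, known): the law along rational points of a plane curve of genus ≤ 1
(verbatim the child statement). -/
def LowGenusCurveLaw : Prop :=
  ∀ (m n : ℕ) (T : Fin m → Fin (n + 1) → MvPolynomial (Fin 2) ℤ) (c : Fin m → ℝ) (C : ℝ), (∀ (F : Type) [Field F] [Algebra ℂ F], Algebra.trdeg ℂ F = 1 → (⊤ : IntermediateField ℂ F).FG → ∀ g : ℕ, (∀ D : Literature.NumberTheory.DiophantineGeometry.AlgFunctionField.Divisor ℂ F, D.degree + 1 - (Literature.NumberTheory.DiophantineGeometry.AlgFunctionField.ell D : ℤ) ≤ g) → ∀ ξ η : F, (∀ j i, MvPolynomial.aeval ![ξ, η] (T j i) ≠ 0) → ∑ j, c j * ∑ᶠ v : Literature.NumberTheory.DiophantineGeometry.AlgFunctionField.PlaceOver ℂ F, ((v.degree : ℝ) * ⨆ i, (-(v.ord (MvPolynomial.aeval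 ![ξ, η] (T j i))) : ℝ)) ≤ C * max 0 (2 * (g : ℝ) - 2)) → ∀ (P : MvPolynomial (Fin 2) ℚ) (hP : Prime P), (haveI : (Ideal.span {P}).IsPrime := (Ideal.span_singleton_prime hP.ne_zero).mpr hP; ∀ D : Literature.NumberTheory.DiophantineGeometry.AlgFunctionField.Divisor ℚ (FractionRing (MvPolynomial (Fin 2) ℚ ⧸ Ideal.span {P})), D.degree + 1 - (Literature.NumberTheory.DiophantineGeometry.AlgFunctionField.ell D : ℤ) ≤ 1) → ∀ δ : ℝ, 0 < δ → ∃ H₀ : ℝ, ∀ x y : ℚ, MvPolynomial.aeval ![x, y] P = 0 → (∀ j i, MvPolynomial.aeval ![x, y] (T j i) ≠ 0) → H₀ ≤ Height.logHeight ![(1 : ℚ), x, y] → ∑ j, c j * Height.logHeight (fun i => MvPolynomial.aeval ![x, y] (T j i)) ≤ δ * Height.logHeight ![(1 : ℚ), x, y]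

/-- **stub 1 — THE LAW DESCENDS TO `ℚ(P)`.** For `P` prime with the genus-≤-1 condition over `ℚ` and all
`T_ji(x̄,ȳ) ≠ 0` in `ℚ(P)`: `Σ_j c_j · deg_j ≤ 0`. Paper proof: let `k'` be the exact constant field of `ℚ(P)`;
the condition forces the genus `g'` of `ℚ(P)/k'` to be ≤ 1 (`sup_D (deg_ℚ D + 1 − ℓ_ℚ D) = [k':ℚ](g'−1) + 1`);
embed `ℚ(P) ↪ ℂ(P₁)` for a geometric component `P₁`; places of `ℚ(P)/ℚ` split into unramified places of `ℂ(P₁)/ℂ`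
with `Σ deg = [k':ℚ]·(residue degree over k')`, so `h_(ℂ(P₁))(T_j(ξ,η)) = h_(ℚ(P)/ℚ)(T_j(x̄,ȳ))/[k':ℚ]`, genus is
preserved, and the hypothesis law with `g = 1` gives `Σ c_j h ≤ C·max(0,0) = 0`. (Stichtenoth III.6.1–6.3.) -/
theorem stub_lawDescends :
    ∀ (m n : ℕ) (T : Fin m → Fin (n + 1) → MvPolynomial (Fin 2) ℤ) (c : Fin m → ℝ) (C : ℝ), (∀ (F : Type) [Field F] [Algebra ℂ F], Algebra.trdeg ℂ F = 1 → (⊤ : IntermediateField ℂ F).FG → ∀ g : ℕ, (∀ D : Literature.NumberTheory.DiophantineGeometry.AlgFunctionField.Divisor ℂ F, D.degree + 1 - (Literature.NumberTheory.DiophantineGeometry.AlgFunctionField.ell D : ℤ) ≤ g) → ∀ ξ η : F, (∀ j i, MvPolynomial.aeval ![ξ, η] (T j i) ≠ 0) → ∑ j, c j * ∑ᶠ v : Literature.NumberTheory.DiophantineGeometry.AlgFunctionField.PlaceOver ℂ F, ((v.degree : ℝ) * ⨆ i, (-(v.ord (MvPolynomial.aeval ![ξ, η] (T j i))) : ℝ))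 ≤ C * max 0 (2 * (g : ℝ) - 2)) → ∀ (P : MvPolynomial (Fin 2) ℚ) (hP : Prime P), (haveI : (Ideal.span {P}).IsPrime := (Ideal.span_singleton_prime hP.ne_zero).mpr hP; (∀ D : Literature.NumberTheory.DiophantineGeometry.AlgFunctionField.Divisor ℚ (FractionRing (MvPolynomial (Fin 2) ℚ ⧸ Ideal.span {P})), D.degree + 1 - (Literature.NumberTheory.DiophantineGeometry.AlgFunctionField.ell D : ℤ) ≤ 1) → (∀ j i, MvPolynomial.aeval ![(algebraMap (MvPolynomial (Fin 2) ℚ ⧸ Ideal.span {P}) (FractionRing (MvPolynomial (Fin 2) ℚ ⧸ Ideal.span {P})) (Ideal.Quotient.mk (Ideal.span {P}) (MvPolynomial.X 0))), (algebraMap (MvPolynomial (Fin 2) ℚ ⧸ Ideal.span {P}) (FractionRing (MvPolynomial (Fin 2) ℚ ⧸ Ideal.span {P})) (Ideal.Quotient.mk (Ideal.span {P}) (MvPolynomial.X 1)))] (T j i) ≠ 0) → ∑ j, c j * (∑ᶠ v : Literature.NumberTheory.DiophantineGeometry.AlgFunctionField.PlaceOver ℚ (FractionRing (MvPolynomial (Fin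 2) ℚ ⧸ Ideal.span {P})), ((v.degree : ℝ) * ⨆ i, (-(v.ord (MvPolynomial.aeval ![(algebraMap (MvPolynomial (Fin 2) ℚ ⧸ Ideal.span {P}) (FractionRing (MvPolynomial (Fin 2) ℚ ⧸ Ideal.span {P})) (Ideal.Quotient.mk (Ideal.span {P}) (MvPolynomial.X 0))), (algebraMap (MvPolynomial (Fin 2) ℚ ⧸ Ideal.span {P}) (FractionRing (MvPolynomial (Fin 2) ℚ ⧸ Ideal.span {P})) (Ideal.Quotient.mk (Ideal.span {P}) (MvPolynomial.X 1)))] (T j i))) : ℝ))) ≤ 0) := by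
  sorry

/-- **stub 2 — THE CURVE HAS POSITIVE PROJECTIVE DEGREE.** For `P` prime, `d = Σ_v deg v·max(0, −ord_v x̄, −ord_v ȳ) > 0`:
`ℚ(P)` has transcendence degree 1 and is generated by `x̄, ȳ`, so one of them is transcendental over `ℚ`, hence has
a pole `v` (Stichtenoth I.1.?? / I.3.4: a non-constant has finitely many, and at least one, poles), contributing
`deg v · (−ord_v) ≥ 1`; all terms are ≥ 0 (the entry `1` has order 0) and the support is finite. -/
theorem stub_projDegreePos :
    ∀ (P : MvPolynomial (Fin 2) ℚ) (hP : Prime P), (haveI : (Ideal.span {P}).IsPrime := (Ideal.span_singleton_prime hP.ne_zero).mpr hP; 0 < (∑ᶠ v : Literature.NumberTheory.DiophantineGeometry.AlgFunctionField.PlaceOver ℚ (FractionRing (MvPolynomial (Fin 2) ℚ ⧸ Ideal.span {P})), ((v.degree : ℝ) * ⨆ i, (-(v.ord ((![(1 : FractionRing (MvPolynomial (Fin 2) ℚ ⧸ Ideal.span {P})), (algebraMap (MvPolynomial (Fin 2) ℚ ⧸ Ideal.span {P}) (FractionRing (MvPolynomial (Fin 2) ℚ ⧸ Ideal.span {P}))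 (Ideal.Quotient.mk (Ideal.span {P}) (MvPolynomial.X 0))), (algebraMap (MvPolynomial (Fin 2) ℚ ⧸ Ideal.span {P}) (FractionRing (MvPolynomial (Fin 2) ℚ ⧸ Ideal.span {P})) (Ideal.Quotient.mk (Ideal.span {P}) (MvPolynomial.X 1)))]) i)) : ℝ)))) := by
  sorry

/-- **stub 3 — HEIGHT MACHINE ON THE CURVE.** For `P` prime and every tuple family `T`: along rational points of
`P = 0` off the curves `T_ji = 0`, `|h(T_j(x,y)) − (deg_j/d)·h(1:x:y)| ≤ ε·h(1:x:y)` beyond a height threshold.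
Paper proof: if `{P=0}(ℚ)` is finite (in particular if `P` is not geometrically irreducible, all rational points
being singular) take `H₀` above all heights; otherwise `ℚ(P)/ℚ` is regular, rational nonsingular affine points are
points of the smooth model `C̃(ℚ)`, `h(T_j(x,y)) = h_(D_j)(p) + O(1)` and `h(1:x:y) = h_(D₀)(p) + O(1)` with
`deg D_j = deg_j`, `deg D₀ = d ≥ 1` (Weil height machine, B–G Thm 2.3.8 / H–S B.3.2), and
`h_(D_j)(p)/h_(D₀)(p) → deg_j/d` (Néron; Hindry–Silverman Thm B.5.9, any genus); if `P ∣ T_ji` the statement is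
vacuous. The finitely many singular points are absorbed into `H₀`. -/
theorem stub_heightMachineOnCurve :
    ∀ (m n : ℕ) (T : Fin m → Fin (n + 1) → MvPolynomial (Fin 2) ℤ) (P : MvPolynomial (Fin 2) ℚ) (hP : Prime P), (haveI : (Ideal.span {P}).IsPrime := (Ideal.span_singleton_prime hP.ne_zero).mpr hP; ∀ ε : ℝ, 0 < ε → ∃ H₀ : ℝ, ∀ x y : ℚ, MvPolynomial.aeval ![x, y] P = 0 → (∀ j i, MvPolynomial.aeval ![x, y] (T j i) ≠ 0) → H₀ ≤ Height.logHeight ![(1 : ℚ), x, y] → ∀ j, |Height.logHeight (fun i => MvPolynomial.aeval ![x, y] (T j i)) - (∑ᶠ v : Literature.NumberTheory.DiophantineGeometry.AlgFunctionField.PlaceOver ℚ (FractionRing (MvPolynomial (Fin 2) ℚ ⧸ Ideal.span {P})), ((v.degree : ℝ) * ⨆ i, (-(v.ord (MvPolynomial.aeval ![(algebraMap (MvPolynomial (Fin 2) ℚ ⧸ Ideal.span {P}) (FractionRing (MvPolynomial (Fin 2) ℚ ⧸ Ideal.span {P})) (Ideal.Quotient.mk (Ideal.span {P}) (MvPolynomial.X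 0))), (algebraMap (MvPolynomial (Fin 2) ℚ ⧸ Ideal.span {P}) (FractionRing (MvPolynomial (Fin 2) ℚ ⧸ Ideal.span {P})) (Ideal.Quotient.mk (Ideal.span {P}) (MvPolynomial.X 1)))] (T j i))) : ℝ))) / (∑ᶠ v : Literature.NumberTheory.DiophantineGeometry.AlgFunctionField.PlaceOver ℚ (FractionRing (MvPolynomial (Fin 2) ℚ ⧸ Ideal.span {P})), ((v.degree : ℝ) * ⨆ i, (-(v.ord ((![(1 : FractionRing (MvPolynomial (Fin 2) ℚ ⧸ Ideal.span {P})), (algebraMap (MvPolynomial (Fin 2) ℚ ⧸ Ideal.span {P}) (FractionRing (MvPolynomial (Fin 2) ℚ ⧸ Ideal.span {P})) (Ideal.Quotient.mk (Ideal.span {P}) (MvPolynomial.X 0))), (algebraMap (MvPolynomial (Fin 2) ℚ ⧸ Ideal.span {P}) (FractionRing (MvPolynomial (Fin 2) ℚ ⧸ Ideal.span {P})) (Ideal.Quotient.mk (Ideal.span {P}) (MvPolynomial.X 1)))]) i)) : ℝ))) * Height.logHeight ![(1 : ℚ), x, y]| ≤ ε * Height.logHeight ![(1 : ℚ), x, y])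 := by
  sorry

/-- Real-number bookkeeping used by the composition (proved). -/
theorem bookkeeping_sum_le {m : ℕ} (c h dg : Fin m → ℝ) (d L ε : ℝ) (hd : 0 < d) (hL : 0 ≤ L)
    (happ : ∀ j, |h j - dg j / d * L| ≤ ε * L) (hdeg : ∑ j, c j * dg j ≤ 0) :
    ∑ j, c j * h j ≤ (∑ j, |c j|) * ε * L := by
  have e : ∀ j, c j * h j ≤ (c j * dg j) * (L / d) + |c j| * (ε * L) := by
    intro j
    have h1 := happ j
    have h2 : c j * (h j - dg j / d * L) ≤ |c j| * (ε * L) := by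
      calc c j * (h j - dg j / d * L) ≤ |c j * (h j - dg j / d * L)| := le_abs_self _
        _ = |c j| * |h j - dg j / d * L| := abs_mul _ _
        _ ≤ |c j| * (ε * L) := mul_le_mul_of_nonneg_left h1 (abs_nonneg _)
    have h3 : c j * h j = (c j * dg j) * (L / d) + c j * (h j - dg j / d * L) := by
      field_simp
      ring
    linarith
  calc ∑ j, c j * h j ≤ ∑ j, ((c j * dg j) * (L / d) + |c j| * (ε * L)) := Finset.sum_le_sum fun j _ => e j
    _ = (∑ j, c j * dg j) * (L / d) + (∑ j, |c j|) * (ε * L) := by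
        rw [Finset.sum_add_distrib, Finset.sum_mul, Finset.sum_mul]
    _ ≤ 0 + (∑ j, |c j|) * (ε * L) := by
        gcongr
        exact mul_nonpos_of_nonpos_of_nonneg hdeg (div_nonneg hL hd.le)
    _ = (∑ j, |c j|) * ε * L := by ring

/-- **Composition (kernel-checked, no sorry):
`stub_lawDescends → stub_projDegreePos → stub_heightMachineOnCurve → LowGenusCurveLaw`.**
If some `T_ji` vanishes identically on the curve (`T_ji(x̄,ȳ) = 0`, i.e. `P ∣ T_ji` in `ℚ[X,Y]`) then no rational
point of `P = 0` lies off the curves `T_ji = 0` and any threshold works; otherwise put `A := Σ|c_j|`,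
`ε := δ/(A+1)`, take `H₀` from stub 3 and combine `h(T_j) = (deg_j/d)L ± εL` (stub 3), `Σ c_j deg_j ≤ 0` (stub 1)
and `d > 0` (stub 2): `Σ c_j h(T_j) ≤ (L/d)·Σ c_j deg_j + AεL ≤ δL`. [folklore] -/
theorem LowGenusCurveLaw_of :
    (∀ (m n : ℕ) (T : Fin m → Fin (n + 1) → MvPolynomial (Fin 2) ℤ) (c : Fin m → ℝ) (C : ℝ), (∀ (F : Type) [Field F] [Algebra ℂ F], Algebra.trdeg ℂ F = 1 → (⊤ : IntermediateField ℂ F).FG → ∀ g : ℕ, (∀ D : Literature.NumberTheory.DiophantineGeometry.AlgFunctionField.Divisor ℂ F, D.degree + 1 - (Literature.NumberTheory.DiophantineGeometry.AlgFunctionField.ell D : ℤ) ≤ g) → ∀ ξ η : F, (∀ j i, MvPolynomial.aeval ![ξ, η] (T j i) ≠ 0) → ∑ j, c j * ∑ᶠ v : Literature.NumberTheory.DiophantineGeometry.AlgFunctionField.PlaceOver ℂ F, ((v.degree : ℝ) * ⨆ i, (-(v.ord (MvPolynomial.aeval ![ξ, η] (T j i))) : ℝ)) ≤ C * max 0 (2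 * (g : ℝ) - 2)) → ∀ (P : MvPolynomial (Fin 2) ℚ) (hP : Prime P), (haveI : (Ideal.span {P}).IsPrime := (Ideal.span_singleton_prime hP.ne_zero).mpr hP; (∀ D : Literature.NumberTheory.DiophantineGeometry.AlgFunctionField.Divisor ℚ (FractionRing (MvPolynomial (Fin 2) ℚ ⧸ Ideal.span {P})), D.degree + 1 - (Literature.NumberTheory.DiophantineGeometry.AlgFunctionField.ell D : ℤ) ≤ 1) → (∀ j i, MvPolynomial.aeval ![(algebraMap (MvPolynomial (Fin 2) ℚ ⧸ Ideal.span {P}) (FractionRing (MvPolynomial (Fin 2) ℚ ⧸ Ideal.span {P})) (Ideal.Quotient.mk (Ideal.span {P}) (MvPolynomial.X 0))), (algebraMap (MvPolynomial (Fin 2) ℚ ⧸ Ideal.span {P}) (FractionRing (MvPolynomial (Fin 2) ℚ ⧸ Ideal.span {P})) (Ideal.Quotient.mk (Ideal.span {P}) (MvPolynomial.X 1)))] (T j i) ≠ 0) → ∑ j, c j * (∑ᶠ v : Literature.NumberTheory.DiophantineGeometry.AlgFunctionField.PlaceOver ℚ (FractionRing (MvPolynomial (Fin 2) ℚ ⧸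 Ideal.span {P})), ((v.degree : ℝ) * ⨆ i, (-(v.ord (MvPolynomial.aeval ![(algebraMap (MvPolynomial (Fin 2) ℚ ⧸ Ideal.span {P}) (FractionRing (MvPolynomial (Fin 2) ℚ ⧸ Ideal.span {P})) (Ideal.Quotient.mk (Ideal.span {P}) (MvPolynomial.X 0))), (algebraMap (MvPolynomial (Fin 2) ℚ ⧸ Ideal.span {P}) (FractionRing (MvPolynomial (Fin 2) ℚ ⧸ Ideal.span {P})) (Ideal.Quotient.mk (Ideal.span {P}) (MvPolynomial.X 1)))] (T j i))) : ℝ))) ≤ 0)) →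
    (∀ (P : MvPolynomial (Fin 2) ℚ) (hP : Prime P), (haveI : (Ideal.span {P}).IsPrime := (Ideal.span_singleton_prime hP.ne_zero).mpr hP; 0 < (∑ᶠ v : Literature.NumberTheory.DiophantineGeometry.AlgFunctionField.PlaceOver ℚ (FractionRing (MvPolynomial (Fin 2) ℚ ⧸ Ideal.span {P})), ((v.degree : ℝ) * ⨆ i, (-(v.ord ((![(1 : FractionRing (MvPolynomial (Fin 2) ℚ ⧸ Ideal.span {P})), (algebraMap (MvPolynomial (Fin 2) ℚ ⧸ Ideal.span {P}) (FractionRing (MvPolynomial (Fin 2) ℚ ⧸ Ideal.span {P})) (Ideal.Quotient.mk (Ideal.span {P}) (MvPolynomial.X 0))), (algebraMap (MvPolynomial (Fin 2) ℚ ⧸ Ideal.span {P}) (FractionRing (MvPolynomial (Fin 2) ℚ ⧸ Ideal.span {P})) (Ideal.Quotient.mk (Ideal.span {P}) (MvPolynomial.X 1)))]) i)) : ℝ))))) →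
    (∀ (m n : ℕ) (T : Fin m → Fin (n + 1) → MvPolynomial (Fin 2) ℤ) (P : MvPolynomial (Fin 2) ℚ) (hP : Prime P), (haveI : (Ideal.span {P}).IsPrime := (Ideal.span_singleton_prime hP.ne_zero).mpr hP; ∀ ε : ℝ, 0 < ε → ∃ H₀ : ℝ, ∀ x y : ℚ, MvPolynomial.aeval ![x, y] P = 0 → (∀ j i, MvPolynomial.aeval ![x, y] (T j i) ≠ 0) → H₀ ≤ Height.logHeight ![(1 : ℚ), x, y] → ∀ j, |Height.logHeight (fun i => MvPolynomial.aeval ![x, y] (T j i)) - (∑ᶠ v : Literature.NumberTheory.DiophantineGeometry.AlgFunctionField.PlaceOver ℚ (FractionRing (MvPolynomial (Fin 2) ℚ ⧸ Ideal.span {P})), ((v.degree : ℝ) * ⨆ i, (-(v.ord (MvPolynomial.aeval ![(algebraMap (MvPolynomial (Fin 2) ℚ ⧸ Ideal.span {P}) (FractionRing (MvPolynomial (Fin 2) ℚ ⧸ Ideal.span {P})) (Ideal.Quotient.mk (Ideal.span {P}) (MvPolynomial.X 0))), (algebraMap (MvPolynomial (Fin 2) ℚ ⧸ Ideal.span {P})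 (FractionRing (MvPolynomial (Fin 2) ℚ ⧸ Ideal.span {P})) (Ideal.Quotient.mk (Ideal.span {P}) (MvPolynomial.X 1)))] (T j i))) : ℝ))) / (∑ᶠ v : Literature.NumberTheory.DiophantineGeometry.AlgFunctionField.PlaceOver ℚ (FractionRing (MvPolynomial (Fin 2) ℚ ⧸ Ideal.span {P})), ((v.degree : ℝ) * ⨆ i, (-(v.ord ((![(1 : FractionRing (MvPolynomial (Fin 2) ℚ ⧸ Ideal.span {P})), (algebraMap (MvPolynomial (Fin 2) ℚ ⧸ Ideal.span {P}) (FractionRing (MvPolynomial (Fin 2) ℚ ⧸ Ideal.span {P})) (Ideal.Quotient.mk (Ideal.span {P}) (MvPolynomial.X 0))), (algebraMap (MvPolynomial (Fin 2) ℚ ⧸ Ideal.span {P}) (FractionRing (MvPolynomial (Fin 2) ℚ ⧸ Ideal.span {P})) (Ideal.Quotient.mk (Ideal.span {P}) (MvPolynomial.X 1)))]) i)) : ℝ))) * Height.logHeight ![(1 : ℚ), x, y]| ≤ ε * Height.logHeight ![(1 : ℚ), x, y])) →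
    LowGenusCurveLaw := by
  intro h1 h2 h3 m n T c C hlaw P hP hg δ hδ
  haveI hprime : (Ideal.span {P}).IsPrime := (Ideal.span_singleton_prime hP.ne_zero).mpr hP
  by_cases hv : ∀ j i, MvPolynomial.aeval ![(algebraMap (MvPolynomial (Fin 2) ℚ ⧸ Ideal.span {P}) (FractionRing (MvPolynomial (Fin 2) ℚ ⧸ Ideal.span {P})) (Ideal.Quotient.mk (Ideal.span {P}) (MvPolynomial.X 0))), (algebraMap (MvPolynomial (Fin 2) ℚ ⧸ Ideal.span {P}) (FractionRing (MvPolynomial (Fin 2) ℚ ⧸ Ideal.span {P})) (Ideal.Quotient.mk (Ideal.span {P}) (MvPolynomial.X 1)))] (T j i) ≠ 0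
  · -- generic case: all `T_ji` are nonzero functions on the curve
    have hdeg := h1 m n T c C hlaw P hP hg hv
    have hd := h2 P hP
    set A : ℝ := ∑ j, |c j| with hA
    have hA0 : 0 ≤ A := Finset.sum_nonneg fun j _ => abs_nonneg _
    have hA1 : 0 < A + 1 := by linarith
    set ε : ℝ := δ / (A + 1) with hε
    have hε0 : 0 < ε := div_pos hδ hA1
    have hAε : A * ε ≤ δ := by
      rw [hε, mul_div_assoc', div_le_iff₀ hA1]
      nlinarith
    obtain ⟨H₀, hH⟩ := h3 m n T P hP ε hε0
    refine ⟨max H₀ 0, fun x y hPxy hT hh => ?_⟩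
    have hH0 : H₀ ≤ Height.logHeight ![(1 : ℚ), x, y] := (le_max_left _ _).trans hh
    have hL0 : 0 ≤ Height.logHeight ![(1 : ℚ), x, y] := (le_max_right _ _).trans hh
    have happ := hH x y hPxy hT hH0
    calc ∑ j, c j * Height.logHeight (fun i => MvPolynomial.aeval ![x, y] (T j i))
        ≤ A * ε * Height.logHeight ![(1 : ℚ), x, y] :=
          bookkeeping_sum_le c (fun j => Height.logHeight (fun i => MvPolynomial.aeval ![x, y] (T j i)))
            (fun j => (∑ᶠ v : Literature.NumberTheory.DiophantineGeometry.AlgFunctionField.PlaceOver ℚ (FractionRing (MvPolynomial (Fin 2) ℚ ⧸ Ideal.span {P})), ((v.degree : ℝ) * ⨆ i, (-(v.ord (MvPolynomial.aeval ![(algebraMap (MvPolynomial (Fin 2) ℚ ⧸ Ideal.span {P}) (FractionRing (MvPolynomial (Fin 2) ℚ ⧸ Ideal.span {P})) (Ideal.Quotient.mk (Ideal.span {P}) (MvPolynomial.X 0))), (algebraMap (MvPolynomial (Fin 2) ℚ ⧸ Ideal.span {P}) (FractionRing (MvPolynomial (Fin 2) ℚ ⧸ Ideal.span {P})) (Ideal.Quotient.mk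 (Ideal.span {P}) (MvPolynomial.X 1)))] (T j i))) : ℝ)))) (∑ᶠ v : Literature.NumberTheory.DiophantineGeometry.AlgFunctionField.PlaceOver ℚ (FractionRing (MvPolynomial (Fin 2) ℚ ⧸ Ideal.span {P})), ((v.degree : ℝ) * ⨆ i, (-(v.ord ((![(1 : FractionRing (MvPolynomial (Fin 2) ℚ ⧸ Ideal.span {P})), (algebraMap (MvPolynomial (Fin 2) ℚ ⧸ Ideal.span {P}) (FractionRing (MvPolynomial (Fin 2) ℚ ⧸ Ideal.span {P})) (Ideal.Quotient.mk (Ideal.span {P}) (MvPolynomial.X 0))), (algebraMap (MvPolynomial (Fin 2) ℚ ⧸ Ideal.span {P}) (FractionRing (MvPolynomial (Fin 2) ℚ ⧸ Ideal.span {P})) (Ideal.Quotient.mk (Ideal.span {P}) (MvPolynomial.X 1)))]) i)) : ℝ))) (Height.logHeight ![(1 : ℚ), x, y]) ε hd hL0 happ hdeg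
      _ ≤ δ * Height.logHeight ![(1 : ℚ), x, y] := mul_le_mul_of_nonneg_right hAε hL0
  · -- degenerate case: some `T_ji` vanishes on the curve, so no admissible rational point lies on it
    push Not at hv
    obtain ⟨j, i, hji⟩ := hv
    refine ⟨0, fun x y hPxy hT _ => ?_⟩
    exfalso
    apply hT j i
    -- the evaluation `ℤ[X,Y] → ℚ(P)` at `(x̄, ȳ)` factors through `ℚ[X,Y] → ℚ[X,Y]/(P) → ℚ(P)`
    have hring : (MvPolynomial.aeval ![(algebraMap (MvPolynomial (Fin 2) ℚ ⧸ Ideal.span {P}) (FractionRing (MvPolynomial (Fin 2) ℚ ⧸ Ideal.span {P})) (Ideal.Quotient.mk (Ideal.span {P}) (MvPolynomial.X 0))), (algebraMap (MvPolynomial (Fin 2) ℚ ⧸ Ideal.span {P}) (FractionRing (MvPolynomial (Fin 2) ℚ ⧸ Ideal.span {P})) (Ideal.Quotient.mk (Ideal.span {P}) (MvPolynomial.X 1)))] : MvPolynomial (Fin 2) ℤ →ₐ[ℤ] (FractionRing (MvPolynomial (Fin 2) ℚ ⧸ Ideal.span {P}))).toRingHom =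
        ((algebraMap (MvPolynomial (Fin 2) ℚ ⧸ Ideal.span {P}) (FractionRing (MvPolynomial (Fin 2) ℚ ⧸ Ideal.span {P}))).comp (Ideal.Quotient.mk (Ideal.span {P}))).comp
          (MvPolynomial.map (Int.castRingHom ℚ)) := by
      apply MvPolynomial.ringHom_ext
      · intro r
        exact congrFun (congrArg DFunLike.coe (RingHom.ext_int
          ((MvPolynomial.aeval ![(algebraMap (MvPolynomial (Fin 2) ℚ ⧸ Ideal.span {P}) (FractionRing (MvPolynomial (Fin 2) ℚ ⧸ Ideal.span {P})) (Ideal.Quotient.mk (Ideal.span {P}) (MvPolynomial.X 0))), (algebraMap (MvPolynomial (Fin 2) ℚ ⧸ Ideal.span {P}) (FractionRing (MvPolynomial (Fin 2) ℚ ⧸ Ideal.span {P})) (Ideal.Quotient.mk (Ideal.span {P}) (MvPolynomial.X 1)))] : MvPolynomial (Fin 2) ℤ →ₐ[ℤ] (FractionRing (MvPolynomial (Fin 2) ℚ ⧸ Ideal.span {P}))).toRingHom.comp MvPolynomial.C)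
          ((((algebraMap (MvPolynomial (Fin 2) ℚ ⧸ Ideal.span {P}) (FractionRing (MvPolynomial (Fin 2) ℚ ⧸ Ideal.span {P}))).comp (Ideal.Quotient.mk (Ideal.span {P}))).comp
            (MvPolynomial.map (Int.castRingHom ℚ))).comp MvPolynomial.C))) r
      · intro i
        fin_cases i <;> simp
    have hTq : (Ideal.Quotient.mk (Ideal.span {P})) (MvPolynomial.map (Int.castRingHom ℚ) (T j i)) = 0 := by
      apply IsFractionRing.injective (MvPolynomial (Fin 2) ℚ ⧸ Ideal.span {P}) (FractionRing (MvPolynomial (Fin 2) ℚ ⧸ Ideal.span {P}))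
      rw [map_zero]
      have := congrArg (fun f : MvPolynomial (Fin 2) ℤ →+* (FractionRing (MvPolynomial (Fin 2) ℚ ⧸ Ideal.span {P})) => f (T j i)) hring
      simp only [AlgHom.toRingHom_eq_coe, RingHom.coe_coe, RingHom.comp_apply] at this
      rw [← this]
      exact hji
    rw [Ideal.Quotient.eq_zero_iff_mem, Ideal.mem_span_singleton'] at hTq
    obtain ⟨Q, hQ⟩ := hTq
    have h' : MvPolynomial.aeval ![x, y] (MvPolynomial.map (Int.castRingHom ℚ) (T j i)) =
        MvPolynomial.aeval ![x, y] (T j i) := by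
      rw [show Int.castRingHom ℚ = algebraMap ℤ ℚ from rfl, MvPolynomial.aeval_map_algebraMap]
    rw [← h', ← hQ, map_mul, hPxy, mul_zero]

end Summit.ABC.ABC.Cruxes.LinearLawTransfer.Split
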